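import Mathlib
import Summits.PneNP.PneNP.Theses.OneSlice
import Summits.PneNP.PneNP.Theorems.OneSliceSliceTargetSplit
import Summits.PneNP.PneNP.Theorems.OneSliceMonotoneContinuationTransportMono

/-!
# Route OneSlice, crux `MonotoneContinuation` (stmt-PneNP-18471), line `Sketch_ideator1_r1` (ProfileLine) — sub-goal `transport_tower_up`

Tower property of the slice transport, upward: for an edge vector `y` of `K_n` with `e(y) ≤ r ≤ j ≤ C(n,2)`,
the slice-`j` transport `T_j g (y)` (the average of `g` over the `j`-supersets of `y`) equals the average over
the `r`-supersets `u` of `y` of `T_j g (u)` (iterated conditioning). Proof: one double counting of the nested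
pairs `u ⊆ x` between the `r`-supersets and the `j`-supersets of `y` — a biregular coupling (every `u` lies
below `#(nbhd j u) = C(C(n,2) - r, j - r)` such `x`, every `x` above `C(j - e(y), r - e(y))` such `u`), along
which the inner average of `T_j g (u)` is exactly the sum over the `x` above `u`
(`towerUp_avg_eq_avg_partialAvg`). The squeezed-slice bookkeeping is the one of the sibling module
`…TransportMono` (`stub_transportMono_card_between`, `…nbhd_eq_between_upper`, `…between_filter_supset/subset`).
-/

set_option linter.dupNamespace false -- `Summit.PneNP.PneNP.…`: summit = sub-problem (D-0017)

namespace Summit.PneNP.PneNP.Theorems.MonotoneContinuation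

open Literature.Computability.Complexity hiding supp mem_supp
open Finset hiding slice
open Filter hiding mem_sdiff
open Classical
open Summit.PneNP.PneNP.Theorems.ConstantBand.Negative (Edge thr Central slice)
open Summit.PneNP.PneNP.Theorems.SliceACZero.Negative (supp mem_supp card_supp supp_injective supp_indicator)
open Summit.PneNP.PneNP.Theorems.SliceTargetSplit (Comp nbhd mem_nbhd transport nbhdCard card_nbhd
  card_nbhd_of_le card_nbhd_of_ge choose_mul_nbhdCard nbhdCard_pos sum_slice_sum_nbhd sum_slice_sum_nbhd_left
  supp_subset_of_comp_of_le comp_iff_supp comp_comm ofSet supp_ofSet ofSet_supp edgeCount_ofSet)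

noncomputable section

variable {n : ℕ}

/-! ### Averaging partial averages along a biregular coupling -/

/-- **Tower identity along a biregular coupling.** If every `a ∈ A` is related to exactly `cA > 0` elements of
`B` and every `b ∈ B` to exactly `cB` elements of the nonempty `A`, then the average of `g` over `B` equals the
average over `a ∈ A` of the averages of `g` over the elements of `B` related to `a` (double counting:
`#A·cA = #B·cB`, and `Σ_a Σ_{b ~ a} g b = cB·Σ_B g`). [folklore] -/
theorem towerUp_avg_eq_avg_partialAvg {α : Type*} {A B : Finset α} (R : α → α → Prop) [DecidableRel R]
    (g : α → ℝ) {cA cB : ℕ}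
    (hA : ∀ a ∈ A, #(B.filter (R a ·)) = cA) (hB : ∀ b ∈ B, #(A.filter (R · b)) = cB)
    (hcA : 0 < cA) (hApos : 0 < #A) :
    (∑ b ∈ B, g b) / #B = (∑ a ∈ A, (∑ b ∈ B.filter (R a ·), g b) / cA) / #A := by
  -- the number of related pairs, counted from both sides
  have hP : #A * cA = #B * cB := card_mul_eq_card_mul R hA hB
  have hPpos : 0 < #B * cB := hP ▸ Nat.mul_pos hApos hcA
  have hBpos : 0 < #B := Nat.pos_of_mul_pos_right hPpos
  -- summing the partial sums over `a` counts every `b` exactly `cB` times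
  have hsum : ∑ a ∈ A, ∑ b ∈ B.filter (R a ·), g b = (cB : ℝ) * ∑ b ∈ B, g b := by
    calc ∑ a ∈ A, ∑ b ∈ B.filter (R a ·), g b = ∑ b ∈ B, ∑ _a ∈ A.filter (R · b), g b := by
          simp_rw [sum_filter]
          exact sum_comm
      _ = ∑ b ∈ B, (cB : ℝ) * g b := by
          refine sum_congr rfl fun b hb => ?_
          rw [sum_const, nsmul_eq_mul, hB b hb]
      _ = (cB : ℝ) * ∑ b ∈ B, g b := by rw [mul_sum]
  have hA' : (0 : ℝ) < #A := by exact_mod_cast hApos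
  have hB' : (0 : ℝ) < #B := by exact_mod_cast hBpos
  have hcA' : (0 : ℝ) < cA := by exact_mod_cast hcA
  have hP' : (#A : ℝ) * cA = #B * cB := by exact_mod_cast hP
  rw [← sum_div, hsum, div_div, div_eq_div_iff hB'.ne' (mul_pos hcA' hA').ne']
  linear_combination (∑ b ∈ B, g b) * hP'

/-! ### The sub-goal -/

/-- **Tower property of the transport, upward** (sub-goal `transport_tower_up` of the line
`Sketch_ideator1_r1`): for `e(y) ≤ r ≤ j ≤ C(n,2)`, the slice-`j` transport at `y` is the average of the
slice-`j` transports over the `r`-supersets of `y`: `T_j g (y) = (Σ_{u ∈ nbhd r y} T_j g (u)) / #(nbhd r y)`.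
Couple `u ∈ nbhd r y` with `x ∈ nbhd j y` by `supp u ⊆ supp x`: the `x` above `u` are exactly `nbhd j u`
(`C(C(n,2) - r, j - r)` of them), the `u` below `x` are the weight-`r` vectors squeezed between `supp y` and
`supp x` (`C(j - e(y), r - e(y))` of them). [folklore] -/
theorem transport_tower_up :
  ∀ (n j r : ℕ) (g : (Edge n → Bool) → ℝ) (y : Edge n → Bool), edgeCount y ≤ r → r ≤ j → j ≤ n.choose 2 →
    transport j g y = (∑ u ∈ nbhd r y, transport j g u) / #(nbhd r y) := by
  intro n j r g y hyr hrj hjN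
  -- an `r`-superset `u` of `y`: weight `r`, support above `supp y`
  have hmem : ∀ u ∈ nbhd r y, edgeCount u = r ∧ supp y ⊆ supp u := by
    intro u hu
    rw [stub_transportMono_nbhd_eq_between_upper hyr, stub_transportMono_mem_between] at hu
    exact ⟨hu.1, hu.2.1⟩
  -- the transport at such a `u` is a partial average over `nbhd j y`
  have key : ∀ u ∈ nbhd r y, transport j g u =
      (∑ x ∈ (nbhd j y).filter (fun x => supp u ⊆ supp x), g x) / ((n.choose 2 - r).choose (j - r) : ℕ) := by
    intro u hu
    obtain ⟨hur, hyu⟩ := hmem u hu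
    have huj : edgeCount u ≤ j := hur.symm ▸ hrj
    unfold transport
    rw [card_nbhd_of_ge huj, hur, stub_transportMono_nbhd_eq_between_upper (hyr.trans hrj),
      stub_transportMono_between_filter_supset hyu, ← stub_transportMono_nbhd_eq_between_upper huj]
  rw [sum_congr rfl key]
  unfold transport
  refine towerUp_avg_eq_avg_partialAvg (fun u x => supp u ⊆ supp x) g
    (cB := (j - edgeCount y).choose (r - edgeCount y)) ?_ ?_ (Nat.choose_pos (by omega)) ?_
  · -- every `u` lies below `#(nbhd j u) = C(C(n,2) - r, j - r)` elements of `nbhd j y`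
    intro u hu
    obtain ⟨hur, hyu⟩ := hmem u hu
    have huj : edgeCount u ≤ j := hur.symm ▸ hrj
    rw [stub_transportMono_nbhd_eq_between_upper (hyr.trans hrj), stub_transportMono_between_filter_supset hyu,
      ← stub_transportMono_nbhd_eq_between_upper huj, card_nbhd_of_ge huj, hur]
  · -- every `x` lies above `C(j - e(y), r - e(y))` elements of `nbhd r y`
    intro x hx
    rw [stub_transportMono_nbhd_eq_between_upper (hyr.trans hrj), stub_transportMono_mem_between] at hx
    obtain ⟨hxj, hyx, -⟩ := hx
    rw [stub_transportMono_nbhd_eq_between_upper hyr,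
      stub_transportMono_between_filter_subset (subset_univ (supp x)),
      stub_transportMono_card_between hyx (by rwa [card_supp]), card_supp, card_supp, hxj]
  · -- `nbhd r y` is nonempty
    rw [card_nbhd_of_ge hyr]
    exact Nat.choose_pos (by omega)

end

end Summit.PneNP.PneNP.Theorems.MonotoneContinuation
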